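import Mathlib
import Literature.NumberTheory.Transcendental.KZDominatedFamilyRelations
import Literature.NumberTheory.Transcendental.SemialgebraicMapsProofs
import Summits.KontsevichZagierPeriods.KontsevichZagierPeriods.Theorems.InverseLandauTateLiftingIsotropyPlaneAux

/-!
# `TateLifting` (stmt-KontsevichZagierPeriods-9129), line `Sketch` — stub 48 `IsotropyPlane`:
# the plane engine of hard-disc cluster integrals

The statement `tateLifting_isotropyPlane` below is VERBATIM the open support item
`IsotropyFactorisation2` of route HardSphereVirial (stmt-KontsevichZagierPeriods-10458,
`Summit.KontsevichZagierPeriods.KontsevichZagierPeriods.Theses.HardSphereVirial.IsotropyFactorisation2`),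
so that that item can be closed by `exact tateLifting_isotropyPlane`; it is also the body of
`IsotropyPlane` (stub 48) of the skeleton `Cruxes/TateLifting/Lines/Sketch.lean`.

**Statement.** Let `σ ⊆ (ℝ²)³ = ℝ⁶` (three points `x₁ = (x 0, x 1)`, `x₂ = (x 2, x 3)`,
`x₃ = (x 4, x 5)`) be `ℚ`-semialgebraic and invariant under the simultaneous action of every
orthogonal `2 × 2` matrix `R` on the three points; let `r = [σ, 1]` and let `q` be the REDUCED
representation on `{w | ρ := w 1 > 0, ((ρ, 0), (w 2, w 3), (w 4, w 5)) ∈ σ}` with integrand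
`2ρ/(1 + u²)`, `u := w 0`. Then `[r] − [q] ∈ KZ.relations`.

**Proof (inside the rules of the Kontsevich–Zagier calculus).**
* (1a) Excise from `σ` the null set `N = {x | x 1 = 0 ∧ x 0 ≤ 0}` (first point on the closed
  non-positive axis; `N` lies in the coordinate hyperplane `{x 1 = 0}`):
  `[σ, 1] − [σ ∖ N, 1] ∈ relations` (`KZ.IntegralRep.of_sub_of_restrict_mem_relations`).
* (2) ONE change of variables (`KZ.changeOfVariablesRel`) from `q` onto `[σ ∖ N, 1]` along the
  tan-half-angle chart `Ψ(u, ρ, y₂, y₃) = (ρ c, ρ s, R y₂, R y₃)`, `c = (1 − u²)/(1 + u²)`,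
  `s = 2u/(1 + u²)`, `R = (c, −s; s, c)` the rotation by the same angle. Its Jacobian is block
  lower-triangular with diagonal blocks `(ρ c′, c; ρ s′, s)` (determinant `−2ρ/(1+u²)`) and two
  copies of `R` (determinant `c² + s² = 1`), so `|det Ψ′| = 2ρ/(1+u²)`; `Ψ` is injective on
  `{ρ > 0}` and maps the reduced domain onto `σ ∖ N` by the invariance hypothesis (applied to `R`
  and to `Rᵀ`; the inverse is `ρ = √(x0² + x1²)`, `u = x1/(ρ + x0)`), and
  `2ρ/(1+u²) = 1 · |det Ψ′|`.

Design: no definitions are introduced (pure proof file). The half-angle functions `c, s`, their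
derivatives, the chart `Ψ` and its Jacobian `Ψ′` are section variables constrained by defining
equations (instantiated by `rfl` in the final proof); the block Jacobian and the half-angle
lemmas are in the auxiliary file `…IsotropyPlaneAux.lean`.

References: M. Kontsevich, D. Zagier, *Periods* (2001), §1.2 rules (1), (2); L. Santaló,
*Integral Geometry and Geometric Probability* (2004), §I.1 (kinematic density of the plane,
`dP ∧ dφ`); J. Bochnak, M. Coste, M.-F. Roy, *Real Algebraic Geometry* (1998), §2.2.
-/

noncomputable section

open MeasureTheory Set
open Literature.NumberTheory.Transcendental
open Literature.ModelTheory.ExponentialFields (IsSemialgebraic isSemialgebraic_setOf_eval_eq_zero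
  isSemialgebraic_setOf_eval_nonneg)

namespace Summit.KontsevichZagierPeriods.InverseLandau

namespace IsotropyPlane

open MvPolynomial (aeval X)

section Chart

variable {c s c' s' : ℝ → ℝ}
  (hc : ∀ u, c u = (1 - u ^ 2) / (1 + u ^ 2)) (hs : ∀ u, s u = 2 * u / (1 + u ^ 2))
  (hc' : ∀ u, c' u = -(4 * u) / (1 + u ^ 2) ^ 2)
  (hs' : ∀ u, s' u = (2 - 2 * u ^ 2) / (1 + u ^ 2) ^ 2)

/-! ### The chart `Ψ(u, ρ, y₂, y₃) = (ρ c, ρ s, R y₂, R y₃)` and its Jacobian -/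

variable {Ψ : (Fin 6 → ℝ) → Fin 6 → ℝ}
  (hΨ : ∀ w, Ψ w = ![w 1 * c (w 0), w 1 * s (w 0), c (w 0) * w 2 - s (w 0) * w 3,
    s (w 0) * w 2 + c (w 0) * w 3, c (w 0) * w 4 - s (w 0) * w 5, s (w 0) * w 4 + c (w 0) * w 5])
  {Ψ' : (Fin 6 → ℝ) → (Fin 6 → ℝ) →L[ℝ] (Fin 6 → ℝ)}
  (hΨ' : ∀ x, Ψ' x = LinearMap.toContinuousLinearMap (Matrix.toLin'
    (Matrix.reindex finSumFinEquiv finSumFinEquiv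
      (Matrix.fromBlocks !![x 1 * c' (x 0), c (x 0); x 1 * s' (x 0), s (x 0)] 0
        !![c' (x 0) * x 2 - s' (x 0) * x 3, 0; s' (x 0) * x 2 + c' (x 0) * x 3, 0;
          c' (x 0) * x 4 - s' (x 0) * x 5, 0; s' (x 0) * x 4 + c' (x 0) * x 5, 0]
        (Matrix.reindex finSumFinEquiv finSumFinEquiv
          (Matrix.fromBlocks !![c (x 0), -s (x 0); s (x 0), c (x 0)] 0 0
            !![c (x 0), -s (x 0); s (x 0), c (x 0)]))) : Matrix (Fin 6) (Fin 6) ℝ)))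

include hc hs hΨ in
/-- The chart is a `ℚ`-semialgebraic map on every `ℚ`-semialgebraic set: each coordinate is a
rational function with denominator `1 + u² ≠ 0`. [cite: BCR1998, §2.2] -/
theorem chart_isSemialgebraicMapOn {D : Set (Fin 6 → ℝ)} (hD : IsSemialgebraic ℚ D) :
    IsSemialgebraicMapOn ℚ D Ψ := by
  have hQ : ∀ x ∈ D, aeval x (1 + X 0 ^ 2 : MvPolynomial (Fin 6) ℚ) ≠ 0 := fun x _ => by
    simp only [map_add, map_one, map_pow, MvPolynomial.aeval_X]
    positivity
  refine IsSemialgebraicMapOn.of_forall hD fun j => ?_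
  fin_cases j
  · refine (isSemialgebraicFunOn_aeval_div_aeval hD (X 1 * (1 - X 0 ^ 2)) (1 + X 0 ^ 2) hQ).congr
      fun x _ => ?_
    simp only [hΨ, hc, map_mul, map_sub, map_add, map_one, map_pow, MvPolynomial.aeval_X,
      Matrix.cons_val, Fin.reduceFinMk]
    ring
  · refine (isSemialgebraicFunOn_aeval_div_aeval hD (X 1 * (2 * X 0)) (1 + X 0 ^ 2) hQ).congr
      fun x _ => ?_
    simp only [hΨ, hs, map_mul, map_add, map_one, map_pow, map_ofNat, MvPolynomial.aeval_X,
      Matrix.cons_val, Fin.reduceFinMk]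
    ring
  · refine (isSemialgebraicFunOn_aeval_div_aeval hD ((1 - X 0 ^ 2) * X 2 - 2 * X 0 * X 3)
      (1 + X 0 ^ 2) hQ).congr fun x _ => ?_
    simp only [hΨ, hc, hs, map_mul, map_sub, map_add, map_one, map_pow, map_ofNat,
      MvPolynomial.aeval_X, Matrix.cons_val, Fin.reduceFinMk]
    ring
  · refine (isSemialgebraicFunOn_aeval_div_aeval hD (2 * X 0 * X 2 + (1 - X 0 ^ 2) * X 3)
      (1 + X 0 ^ 2) hQ).congr fun x _ => ?_
    simp only [hΨ, hc, hs, map_mul, map_sub, map_add, map_one, map_pow, map_ofNat,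
      MvPolynomial.aeval_X, Matrix.cons_val, Fin.reduceFinMk]
    ring
  · refine (isSemialgebraicFunOn_aeval_div_aeval hD ((1 - X 0 ^ 2) * X 4 - 2 * X 0 * X 5)
      (1 + X 0 ^ 2) hQ).congr fun x _ => ?_
    simp only [hΨ, hc, hs, map_mul, map_sub, map_add, map_one, map_pow, map_ofNat,
      MvPolynomial.aeval_X, Matrix.cons_val, Fin.reduceFinMk]
    ring
  · refine (isSemialgebraicFunOn_aeval_div_aeval hD (2 * X 0 * X 4 + (1 - X 0 ^ 2) * X 5)
      (1 + X 0 ^ 2) hQ).congr fun x _ => ?_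
    simp only [hΨ, hc, hs, map_mul, map_sub, map_add, map_one, map_pow, map_ofNat,
      MvPolynomial.aeval_X, Matrix.cons_val, Fin.reduceFinMk]
    ring

include hc hs hc' hs' hΨ hΨ' in
/-- The chart is differentiable, with derivative the block Jacobian `Ψ′`. [folklore] -/
theorem chart_hasFDerivAt (x : Fin 6 → ℝ) : HasFDerivAt Ψ (Ψ' x) x := by
  have hP : ∀ i : Fin 6, HasFDerivAt (fun w : Fin 6 → ℝ => w i)
      (ContinuousLinearMap.proj (R := ℝ) (φ := fun _ : Fin 6 => ℝ) i) x :=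
    fun i => hasFDerivAt_apply i x
  have hcx : HasFDerivAt (fun w : Fin 6 → ℝ => c (w 0))
      (c' (x 0) • ContinuousLinearMap.proj (R := ℝ) (φ := fun _ : Fin 6 => ℝ) 0) x :=
    (hasDerivAt_halfAngle_c hc hc' (x 0)).comp_hasFDerivAt x (hP 0)
  have hsx : HasFDerivAt (fun w : Fin 6 → ℝ => s (w 0))
      (s' (x 0) • ContinuousLinearMap.proj (R := ℝ) (φ := fun _ : Fin 6 => ℝ) 0) x :=
    (hasDerivAt_halfAngle_s hs hs' (x 0)).comp_hasFDerivAt x (hP 0)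
  rw [show Ψ = fun w => ![w 1 * c (w 0), w 1 * s (w 0), c (w 0) * w 2 - s (w 0) * w 3,
    s (w 0) * w 2 + c (w 0) * w 3, c (w 0) * w 4 - s (w 0) * w 5, s (w 0) * w 4 + c (w 0) * w 5]
    from funext hΨ, hΨ', hasFDerivAt_pi']
  intro i
  fin_cases i
  · show HasFDerivAt (fun w : Fin 6 → ℝ => w 1 * c (w 0)) _ x
    refine ((hP 1).mul hcx).congr_fderiv (ContinuousLinearMap.ext fun v => ?_)
    simp only [_root_.add_apply, _root_.smul_apply,
      ContinuousLinearMap.coe_comp, Function.comp_apply, ContinuousLinearMap.proj_apply,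
      LinearMap.coe_toContinuousLinearMap', Matrix.toLin'_apply, blockJac_mulVec, smul_eq_mul,
      Matrix.cons_val, Fin.reduceFinMk]
    ring
  · show HasFDerivAt (fun w : Fin 6 → ℝ => w 1 * s (w 0)) _ x
    refine ((hP 1).mul hsx).congr_fderiv (ContinuousLinearMap.ext fun v => ?_)
    simp only [_root_.add_apply, _root_.smul_apply,
      ContinuousLinearMap.coe_comp, Function.comp_apply, ContinuousLinearMap.proj_apply,
      LinearMap.coe_toContinuousLinearMap', Matrix.toLin'_apply, blockJac_mulVec, smul_eq_mul,
      Matrix.cons_val, Fin.reduceFinMk]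
    ring
  · show HasFDerivAt (fun w : Fin 6 → ℝ => c (w 0) * w 2 - s (w 0) * w 3) _ x
    refine ((hcx.mul (hP 2)).sub (hsx.mul (hP 3))).congr_fderiv
      (ContinuousLinearMap.ext fun v => ?_)
    simp only [_root_.add_apply, _root_.sub_apply,
      _root_.smul_apply, ContinuousLinearMap.coe_comp, Function.comp_apply,
      ContinuousLinearMap.proj_apply, LinearMap.coe_toContinuousLinearMap', Matrix.toLin'_apply,
      blockJac_mulVec, smul_eq_mul, Matrix.cons_val, Fin.reduceFinMk]
    ring
  · show HasFDerivAt (fun w : Fin 6 → ℝ => s (w 0) * w 2 + c (w 0) * w 3) _ x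
    refine ((hsx.mul (hP 2)).add (hcx.mul (hP 3))).congr_fderiv
      (ContinuousLinearMap.ext fun v => ?_)
    simp only [_root_.add_apply, _root_.smul_apply,
      ContinuousLinearMap.coe_comp, Function.comp_apply, ContinuousLinearMap.proj_apply,
      LinearMap.coe_toContinuousLinearMap', Matrix.toLin'_apply, blockJac_mulVec, smul_eq_mul,
      Matrix.cons_val, Fin.reduceFinMk]
    ring
  · show HasFDerivAt (fun w : Fin 6 → ℝ => c (w 0) * w 4 - s (w 0) * w 5) _ x
    refine ((hcx.mul (hP 4)).sub (hsx.mul (hP 5))).congr_fderiv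
      (ContinuousLinearMap.ext fun v => ?_)
    simp only [_root_.add_apply, _root_.sub_apply,
      _root_.smul_apply, ContinuousLinearMap.coe_comp, Function.comp_apply,
      ContinuousLinearMap.proj_apply, LinearMap.coe_toContinuousLinearMap', Matrix.toLin'_apply,
      blockJac_mulVec, smul_eq_mul, Matrix.cons_val, Fin.reduceFinMk]
    ring
  · show HasFDerivAt (fun w : Fin 6 → ℝ => s (w 0) * w 4 + c (w 0) * w 5) _ x
    refine ((hsx.mul (hP 4)).add (hcx.mul (hP 5))).congr_fderiv
      (ContinuousLinearMap.ext fun v => ?_)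
    simp only [_root_.add_apply, _root_.smul_apply,
      ContinuousLinearMap.coe_comp, Function.comp_apply, ContinuousLinearMap.proj_apply,
      LinearMap.coe_toContinuousLinearMap', Matrix.toLin'_apply, blockJac_mulVec, smul_eq_mul,
      Matrix.cons_val, Fin.reduceFinMk]
    ring

include hc hs hc' hs' hΨ' in
/-- The Jacobian determinant of the chart: `det Ψ′ = −2ρ/(1 + u²)` (`ρ = x 1`, `u = x 0`).
[folklore] -/
theorem chart_det (x : Fin 6 → ℝ) : (Ψ' x).det = -(2 * x 1 / (1 + x 0 ^ 2)) := by
  rw [hΨ']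
  change LinearMap.det (Matrix.toLin' (_ : Matrix (Fin 6) (Fin 6) ℝ)) = _
  rw [LinearMap.det_toLin', det_blockJac, halfAngle_sq_add_sq hc hs (x 0),
    det_polarBlock hc hs hc' hs']
  ring

include hc hs hΨ in
/-- The chart is injective on `{ρ > 0}`. [folklore] -/
theorem chart_injOn : InjOn Ψ {w | 0 < w 1} := by
  intro w hw w' hw' h
  have hw1 : 0 < w 1 := hw
  have hw1' : 0 < w' 1 := hw'
  have e : ∀ i, Ψ w i = Ψ w' i := fun i => by rw [h]
  have e0 := e 0
  have e1 := e 1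
  have e2 := e 2
  have e3 := e 3
  have e4 := e 4
  have e5 := e 5
  simp only [hΨ, Matrix.cons_val] at e0 e1 e2 e3 e4 e5
  have hA := halfAngle_sq_add_sq hc hs (w 0)
  have hB := halfAngle_sq_add_sq hc hs (w' 0)
  have h11 : w 1 ^ 2 = w' 1 ^ 2 := by
    linear_combination (w 1 * c (w 0) + w' 1 * c (w' 0)) * e0 +
      (w 1 * s (w 0) + w' 1 * s (w' 0)) * e1 - (w 1) ^ 2 * hA + (w' 1) ^ 2 * hB
  have h1 : w 1 = w' 1 := (pow_left_inj₀ hw1.le hw1'.le two_ne_zero).1 h11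
  rw [← h1] at e0 e1
  have hcc : c (w 0) = c (w' 0) := mul_left_cancel₀ hw1.ne' e0
  have hss : s (w 0) = s (w' 0) := mul_left_cancel₀ hw1.ne' e1
  have h0 : w 0 = w' 0 := halfAngle_inj hc hs hcc hss
  rw [← h0] at e2 e3 e4 e5
  have h2 : w 2 = w' 2 := by
    linear_combination c (w 0) * e2 + s (w 0) * e3 - (w 2 - w' 2) * hA
  have h3 : w 3 = w' 3 := by
    linear_combination (-s (w 0)) * e2 + c (w 0) * e3 - (w 3 - w' 3) * hA
  have h4 : w 4 = w' 4 := by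
    linear_combination c (w 0) * e4 + s (w 0) * e5 - (w 4 - w' 4) * hA
  have h5 : w 5 = w' 5 := by
    linear_combination (-s (w 0)) * e4 + c (w 0) * e5 - (w 5 - w' 5) * hA
  funext i
  fin_cases i <;> assumption

include hc hs hΨ in
/-- The chart maps the reduced domain `{ρ > 0, ((ρ, 0), y₂, y₃) ∈ σ}` ONTO `σ ∖ N`,
`N = {x 1 = 0, x 0 ≤ 0}`, for every `σ` invariant under the diagonal action of `O(2)`
(rotate by `R` one way, by `Rᵀ` the other way). [folklore] -/
theorem chart_image (σ : Set (Fin 6 → ℝ))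
    (hO : ∀ R : Matrix (Fin 2) (Fin 2) ℝ, R.transpose * R = 1 → ∀ x : Fin 6 → ℝ,
      x ∈ σ ↔ (![(R.mulVec ![x 0, x 1]) 0, (R.mulVec ![x 0, x 1]) 1, (R.mulVec ![x 2, x 3]) 0,
        (R.mulVec ![x 2, x 3]) 1, (R.mulVec ![x 4, x 5]) 0, (R.mulVec ![x 4, x 5]) 1] :
          Fin 6 → ℝ) ∈ σ) :
    Ψ '' {w | 0 < w 1 ∧ (![w 1, 0, w 2, w 3, w 4, w 5] : Fin 6 → ℝ) ∈ σ} =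
      σ \ {x | x 1 = 0 ∧ x 0 ≤ 0} := by
  apply Subset.antisymm
  · rintro _ ⟨w, ⟨hw1, hwσ⟩, rfl⟩
    have hw1 : 0 < w 1 := hw1
    have hcs := halfAngle_sq_add_sq hc hs (w 0)
    refine ⟨?_, ?_⟩
    · have h := (hO !![c (w 0), -s (w 0); s (w 0), c (w 0)]
        (rot_transpose_mul_self _ _ hcs) _).1 hwσ
      simp only [mulVec_two, Matrix.cons_val] at h
      convert h using 1
      rw [hΨ]
      funext i
      fin_cases i <;> simp only [Matrix.cons_val, Fin.reduceFinMk] <;> ring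
    · rintro ⟨h1, h0⟩
      rw [hΨ] at h0 h1
      simp only [Matrix.cons_val] at h0 h1
      have hs0 : s (w 0) = 0 := (mul_eq_zero.1 h1).resolve_left hw1.ne'
      have hu : w 0 = 0 := halfAngle_s_eq_zero hs hs0
      rw [hu, halfAngle_c_zero hc] at h0
      linarith
  · rintro x ⟨hxσ, hxN⟩
    obtain ⟨u, ρ, hρ, hx0, hx1⟩ := polar_exists hc hs (x 0) (x 1) hxN
    have hcs := halfAngle_sq_add_sq hc hs u
    have hcs' : c u ^ 2 + (-s u) ^ 2 = 1 := by rw [neg_sq]; exact hcs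
    have h := (hO !![c u, s u; -s u, c u] (by simpa using rot_transpose_mul_self (c u) (-s u) hcs')
      x).1 hxσ
    simp only [mulVec_two, Matrix.cons_val] at h
    have k0 : c u * x 0 + s u * x 1 = ρ := by rw [hx0, hx1]; linear_combination ρ * hcs
    have k1 : -s u * x 0 + c u * x 1 = 0 := by rw [hx0, hx1]; ring
    rw [k0, k1] at h
    refine ⟨![u, ρ, c u * x 2 + s u * x 3, -s u * x 2 + c u * x 3, c u * x 4 + s u * x 5,
      -s u * x 4 + c u * x 5], ⟨?_, ?_⟩, ?_⟩
    · show 0 < ρ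
      exact hρ
    · simpa using h
    · rw [hΨ]
      funext i
      fin_cases i
      · simp only [Matrix.cons_val, Fin.reduceFinMk]
        exact hx0.symm
      · simp only [Matrix.cons_val, Fin.reduceFinMk]
        exact hx1.symm
      · simp only [Matrix.cons_val, Fin.reduceFinMk]
        linear_combination x 2 * hcs
      · simp only [Matrix.cons_val, Fin.reduceFinMk]
        linear_combination x 3 * hcs
      · simp only [Matrix.cons_val, Fin.reduceFinMk]
        linear_combination x 4 * hcs
      · simp only [Matrix.cons_val, Fin.reduceFinMk]
        linear_combination x 5 * hcs

end Chart

end IsotropyPlane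

open IsotropyPlane in
/-- **The plane engine of hard-disc cluster integrals** (stub 48 `IsotropyPlane` of the line
`Sketch` for `TateLifting`, stmt-KontsevichZagierPeriods-9129; VERBATIM the support item
`IsotropyFactorisation2` of route HardSphereVirial, stmt-KontsevichZagierPeriods-10458). For a
`ℚ`-semialgebraic `σ ⊆ (ℝ²)³` invariant under the diagonal action of `O(2)`, the integrand-`1`
representation `r = [σ, 1]` differs by KZ relations from the reduced representation `q` over
`{(u, ρ, y₂, y₃) | ρ > 0, ((ρ, 0), y₂, y₃) ∈ σ}` with integrand `2ρ/(1 + u²)`: excise the null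
set `{x 1 = 0, x 0 ≤ 0}` (rule (1a)), then ONE change of variables (rule (2)) along the
tan-half-angle chart, Jacobian `|det Ψ′| = 2ρ/(1 + u²)`.
[cite: KontsevichZagier2001, §1.2 rule (2)] -/
theorem tateLifting_isotropyPlane :
  ∀ (σ : Set (Fin 6 → ℝ)), IsSemialgebraic ℚ σ →
    (∀ R : Matrix (Fin 2) (Fin 2) ℝ, R.transpose * R = 1 → ∀ x : Fin 6 → ℝ,
      x ∈ σ ↔ (![(R.mulVec ![x 0, x 1]) 0, (R.mulVec ![x 0, x 1]) 1, (R.mulVec ![x 2, x 3]) 0,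
        (R.mulVec ![x 2, x 3]) 1, (R.mulVec ![x 4, x 5]) 0, (R.mulVec ![x 4, x 5]) 1] : Fin 6 → ℝ) ∈ σ) →
    ∀ (r : KZ.IntegralRep 6), r.domain = σ → (∀ x ∈ r.domain, r.integrand x = 1) →
    ∀ (q : KZ.IntegralRep 6),
      q.domain = {w | 0 < w 1 ∧ (![w 1, 0, w 2, w 3, w 4, w 5] : Fin 6 → ℝ) ∈ σ} →
      (∀ w ∈ q.domain, q.integrand w = 2 / (1 + w 0 ^ 2) * w 1) →
      KZ.of r - KZ.of q ∈ KZ.relations := by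
  intro σ _hσ hO r hr hr1 q hq hq1
  subst hr
  -- the half-angle functions, the chart and its Jacobian, abstracted behind defining equations
  obtain ⟨c, hc⟩ : ∃ c : ℝ → ℝ, ∀ u, c u = (1 - u ^ 2) / (1 + u ^ 2) := ⟨_, fun _ => rfl⟩
  obtain ⟨s, hs⟩ : ∃ s : ℝ → ℝ, ∀ u, s u = 2 * u / (1 + u ^ 2) := ⟨_, fun _ => rfl⟩
  obtain ⟨c', hc'⟩ : ∃ c' : ℝ → ℝ, ∀ u, c' u = -(4 * u) / (1 + u ^ 2) ^ 2 := ⟨_, fun _ => rfl⟩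
  obtain ⟨s', hs'⟩ : ∃ s' : ℝ → ℝ, ∀ u, s' u = (2 - 2 * u ^ 2) / (1 + u ^ 2) ^ 2 :=
    ⟨_, fun _ => rfl⟩
  obtain ⟨Ψ, hΨ⟩ : ∃ Ψ : (Fin 6 → ℝ) → Fin 6 → ℝ, ∀ w, Ψ w = ![w 1 * c (w 0), w 1 * s (w 0),
      c (w 0) * w 2 - s (w 0) * w 3, s (w 0) * w 2 + c (w 0) * w 3, c (w 0) * w 4 - s (w 0) * w 5,
      s (w 0) * w 4 + c (w 0) * w 5] := ⟨_, fun _ => rfl⟩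
  obtain ⟨Ψ', hΨ'⟩ : ∃ Ψ' : (Fin 6 → ℝ) → (Fin 6 → ℝ) →L[ℝ] (Fin 6 → ℝ), ∀ x, Ψ' x =
      LinearMap.toContinuousLinearMap (Matrix.toLin'
        (Matrix.reindex finSumFinEquiv finSumFinEquiv
          (Matrix.fromBlocks !![x 1 * c' (x 0), c (x 0); x 1 * s' (x 0), s (x 0)] 0
            !![c' (x 0) * x 2 - s' (x 0) * x 3, 0; s' (x 0) * x 2 + c' (x 0) * x 3, 0;
              c' (x 0) * x 4 - s' (x 0) * x 5, 0; s' (x 0) * x 4 + c' (x 0) * x 5, 0]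
            (Matrix.reindex finSumFinEquiv finSumFinEquiv
              (Matrix.fromBlocks !![c (x 0), -s (x 0); s (x 0), c (x 0)] 0 0
                !![c (x 0), -s (x 0); s (x 0), c (x 0)]))) : Matrix (Fin 6) (Fin 6) ℝ)) :=
    ⟨_, fun _ => rfl⟩
  -- (1a) excise the null set `N = {x 1 = 0, x 0 ≤ 0}`
  have hN : IsSemialgebraic ℚ {x : Fin 6 → ℝ | x 1 = 0 ∧ x 0 ≤ 0} := by
    have h1 := isSemialgebraic_setOf_eval_eq_zero (k := ℚ) (R := ℝ)
      (MvPolynomial.X 1 : MvPolynomial (Fin 6) ℚ)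
    have h2 := isSemialgebraic_setOf_eval_nonneg (k := ℚ) (R := ℝ)
      (-MvPolynomial.X 0 : MvPolynomial (Fin 6) ℚ)
    convert h1.inter h2 using 1
    ext x
    simp
  have hE : IsSemialgebraic ℚ (r.domain \ {x | x 1 = 0 ∧ x 0 ≤ 0}) :=
    r.isSemialgebraic_domain.diff hN
  have hEr : r.domain \ {x | x 1 = 0 ∧ x 0 ≤ 0} ⊆ r.domain := fun x hx => hx.1
  have hvol : volume (r.domain \ (r.domain \ {x : Fin 6 → ℝ | x 1 = 0 ∧ x 0 ≤ 0})) = 0 := by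
    have hplane : volume {x : Fin 6 → ℝ | x 1 = 0} = 0 := by
      rw [volume_pi]
      exact Measure.pi_hyperplane _ 1 0
    refine measure_mono_null (fun x hx => ?_) hplane
    have hxN : x ∈ {x : Fin 6 → ℝ | x 1 = 0 ∧ x 0 ≤ 0} := by
      by_contra h
      exact hx.2 ⟨hx.1, h⟩
    exact hxN.1
  have h1 : KZ.of r - KZ.of (r.restrict _ hE hEr) ∈ KZ.relations :=
    KZ.IntegralRep.of_sub_of_restrict_mem_relations r hE hEr hvol
  -- (2) one change of variables from `q` onto `[σ ∖ N, 1]`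
  have himage : Ψ '' q.domain = r.domain \ {x | x 1 = 0 ∧ x 0 ≤ 0} := by
    rw [hq]
    exact chart_image hc hs hΨ r.domain hO
  have h2 : KZ.of q - KZ.of (r.restrict _ hE hEr) ∈ KZ.relations := by
    refine KZ.changeOfVariablesRel_subset_relations ⟨6, q, r.restrict _ hE hEr, Ψ, Ψ',
      chart_isSemialgebraicMapOn hc hs hΨ q.isSemialgebraic_domain,
      fun x _ => (chart_hasFDerivAt hc hs hc' hs' hΨ hΨ' x).hasFDerivWithinAt,
      (chart_injOn hc hs hΨ).mono (fun w hw => ?_), himage.symm, fun x hx => ?_, rfl⟩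
    · rw [hq] at hw
      exact hw.1
    · have hxE : Ψ x ∈ r.domain \ {x | x 1 = 0 ∧ x 0 ≤ 0} := himage ▸ mem_image_of_mem Ψ hx
      have hx1 : 0 < x 1 := by
        rw [hq] at hx
        exact hx.1
      rw [hq1 x hx, KZ.IntegralRep.integrand_restrict, hr1 _ hxE.1,
        chart_det hc hs hc' hs' hΨ' x, abs_neg, abs_of_pos (by positivity)]
      ring
  have e : KZ.of r - KZ.of q =
      (KZ.of r - KZ.of (r.restrict _ hE hEr)) - (KZ.of q - KZ.of (r.restrict _ hE hEr)) := by
    abel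
  rw [e]
  exact KZ.relations.sub_mem h1 h2

end Summit.KontsevichZagierPeriods.InverseLandau

end
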